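import Summits.QuantumFields.QCD.Theorems.SpectralDefectExtinctionWindowExtinctionCornerSingleLinkArcRemez

/-!
# Single-link resonance (S2c of line `corner-decorrelation-deep-hole`): the weight sup bound
(crux `Summit.QuantumFields.QCD.Theses.SpectralDefectExtinction.WindowExtinction`, item stmt-QuantumFields-18063)

The one probabilistic input S2c (`stub_singleLinkResonance`) prices a plaquette eigenphase under the
single-link law `∝ e^{−βS_W} ∏_f |det D_W| dHaar`.  Along every one-parameter circle `t ↦ U[e ↦ U(e)c(t)]`
of the link this weight has the shape

  `h(t) = ‖Q(e^{it})‖ · exp (A + κ cos (t − t₀))`,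

`Q` a complex polynomial of degree `≤ m` (the `|det|` tilt, `m ≤ 48 N_f`) and `κ = O(β)` (the Boltzmann
factor of the six plaquettes through the link).  This file proves the "von Mises–Remez" sup bound

  `h(t⋆) ≤ 3 (50m+51)^m √(1+κ) · ∫_{(0,2π]} h`       (`cornerSL_weight_sup`, stated with `∫⁻`),

uniformly in `A`, `t₀`, `t⋆`: the single-link conditional law cannot concentrate below scale `1/√(1+κ)`.
Proof: on the interval `J` of length `ℓ = 1/√(1+κ)` starting at `t⋆` and pointing towards the maximum
`t₀` of the cosine, `κ cos (t − t₀) ≥ κ cos (t⋆ − t₀) − ½` (one-sided second-order control of `cos`,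
`κℓ² ≤ 1`); on three quarters of `J`, `‖Q(e^{it⋆})‖ ≤ (50m+51)^m ‖Q(e^{it})‖` (the landed arc-doubling
bound `cornerSL_arc_doubling`); integrate over that good set and use `2π`-periodicity of `h` to compare
`∫_J h` with `∫_{(0,2π]} h`.
-/

noncomputable section

namespace Summit.QuantumFields.QCD.Cruxes.WindowExtinction.CornerDecorrelationDeepHole

open scoped BigOperators Real ENNReal
open MeasureTheory Complex Polynomial Set

/-! ### One-sided second-order control of the cosine -/

/-- If `sin s ≤ 0` then moving forward by `u ∈ [0, 1]` costs at most `u²/2`: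
`cos s − u²/2 ≤ cos (s + u)`. -/
theorem cornerSL_cos_sub_le_cos_add {s u : ℝ} (hu0 : 0 ≤ u) (hu1 : u ≤ 1) (hs : Real.sin s ≤ 0) :
    Real.cos s - u ^ 2 / 2 ≤ Real.cos (s + u) := by
  rw [Real.cos_add]
  have hπ := Real.pi_gt_three
  have hsu : 0 ≤ Real.sin u := Real.sin_nonneg_of_nonneg_of_le_pi hu0 (by linarith)
  have hcu : 1 - u ^ 2 / 2 ≤ Real.cos u := Real.one_sub_sq_div_two_le_cos
  have hcu1 : Real.cos u ≤ 1 := Real.cos_le_one u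
  have hc1 : Real.cos s ≤ 1 := Real.cos_le_one s
  nlinarith [mul_nonneg (sub_nonneg.2 hc1) (sub_nonneg.2 hcu1), mul_nonneg hsu (neg_nonneg.2 hs)]

/-- If `0 ≤ sin s` then moving backward by `u ∈ [0, 1]` costs at most `u²/2`:
`cos s − u²/2 ≤ cos (s − u)`. -/
theorem cornerSL_cos_sub_le_cos_sub {s u : ℝ} (hu0 : 0 ≤ u) (hu1 : u ≤ 1) (hs : 0 ≤ Real.sin s) :
    Real.cos s - u ^ 2 / 2 ≤ Real.cos (s - u) := by
  have h := cornerSL_cos_sub_le_cos_add (s := -s) hu0 hu1 (by rw [Real.sin_neg]; linarith)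
  rw [Real.cos_neg, show -s + u = -(s - u) by ring, Real.cos_neg] at h
  exact h

/-! ### Periodicity of circle integrals -/

/-- For a `2π`-periodic `f ≥ 0`, `∫⁻_{(a, a+2π]} f` does not depend on `a`. -/
theorem cornerSL_lintegral_Ioc_periodic {f : ℝ → ℝ≥0∞} (hf : Function.Periodic f (2 * π)) (a b : ℝ) :
    ∫⁻ t in Ioc a (a + 2 * π), f t = ∫⁻ t in Ioc b (b + 2 * π), f t := by
  haveI : Fact (0 < 2 * π) := ⟨Real.two_pi_pos⟩
  have h1 := AddCircle.lintegral_preimage (T := 2 * π) a hf.lift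
  have h2 := AddCircle.lintegral_preimage (T := 2 * π) b hf.lift
  simp only [Function.Periodic.lift_coe] at h1 h2
  rw [h1, h2]

/-! ### The weight along a circle -/

/-- The circle weight `h(t) = ‖Q(e^{it})‖ · exp (A + κ cos (t − t₀))` is continuous. -/
theorem cornerSL_weight_continuous (Q : ℂ[X]) (A κ t₀ : ℝ) :
    Continuous fun t : ℝ => ‖Q.eval (exp (t * I))‖ * Real.exp (A + κ * Real.cos (t - t₀)) := by
  have h1 : Continuous fun t : ℝ => Q.eval (exp (t * I)) :=
    Q.continuous.comp (continuous_exp.comp (continuous_ofReal.mul continuous_const))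
  exact h1.norm.mul (Real.continuous_exp.comp (continuous_const.add
    (continuous_const.mul (Real.continuous_cos.comp (continuous_id.sub continuous_const)))))

/-- The circle weight is `2π`-periodic. -/
theorem cornerSL_weight_periodic (Q : ℂ[X]) (A κ t₀ : ℝ) :
    Function.Periodic (fun t : ℝ => ‖Q.eval (exp (t * I))‖ * Real.exp (A + κ * Real.cos (t - t₀)))
      (2 * π) := by
  intro t
  simp only
  have h1 : exp (((t + 2 * π : ℝ) : ℂ) * I) = exp (t * I) := by
    push_cast
    rw [add_mul, exp_add, exp_two_pi_mul_I, mul_one]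
  have h2 : Real.cos (t + 2 * π - t₀) = Real.cos (t - t₀) := by
    rw [show t + 2 * π - t₀ = (t - t₀) + 2 * π by ring, Real.cos_add_two_pi]
  rw [h1, h2]

/-- **The weight sup bound (von Mises–Remez).**  For a complex polynomial `Q` of degree `≤ m`, reals
`A`, `t₀`, `κ ≥ 0` and EVERY `t⋆`:
`‖Q(e^{it⋆})‖ e^{A + κ cos(t⋆ − t₀)} ≤ 3 (50m+51)^m √(1+κ) · ∫⁻_{(0,2π]} ‖Q(e^{it})‖ e^{A + κ cos(t − t₀)} dt`. -/
theorem cornerSL_weight_sup (m : ℕ) (Q : ℂ[X]) (hQ : Q.natDegree ≤ m) (A κ t₀ : ℝ) (hκ : 0 ≤ κ)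
    (tstar : ℝ) :
    ENNReal.ofReal (‖Q.eval (exp (tstar * I))‖ * Real.exp (A + κ * Real.cos (tstar - t₀))) ≤
      ENNReal.ofReal (3 * (50 * m + 51 : ℝ) ^ m * Real.sqrt (1 + κ)) *
        ∫⁻ t in Ioc 0 (2 * π),
          ENNReal.ofReal (‖Q.eval (exp (t * I))‖ * Real.exp (A + κ * Real.cos (t - t₀))) := by
  set h : ℝ → ℝ := fun t => ‖Q.eval (exp (t * I))‖ * Real.exp (A + κ * Real.cos (t - t₀)) with hh
  have hh0 : ∀ t, 0 ≤ h t := fun t => mul_nonneg (norm_nonneg _) (Real.exp_pos _).le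
  have hπ := Real.pi_gt_three
  -- constants
  set K : ℝ := (50 * m + 51 : ℝ) ^ m with hK
  have hm0 : (0 : ℝ) ≤ m := Nat.cast_nonneg m
  have hK1 : 1 ≤ K := one_le_pow₀ (by linarith)
  have hK0 : 0 < K := by linarith
  set ℓ : ℝ := 1 / Real.sqrt (1 + κ) with hℓ
  have hsq1 : 1 ≤ Real.sqrt (1 + κ) := by
    calc (1 : ℝ) = Real.sqrt 1 := Real.sqrt_one.symm
      _ ≤ Real.sqrt (1 + κ) := Real.sqrt_le_sqrt (by linarith)
  have hsq0 : 0 < Real.sqrt (1 + κ) := by linarith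
  have hℓ0 : 0 < ℓ := by rw [hℓ]; positivity
  have hℓ1 : ℓ ≤ 1 := by rw [hℓ, div_le_one hsq0]; exact hsq1
  have hκℓ : κ * ℓ ^ 2 ≤ 1 := by
    rw [hℓ, div_pow, one_pow, Real.sq_sqrt (by linarith), mul_one_div, div_le_one (by linarith)]
    linarith
  -- the interval `J = [p, q]` of length `ℓ` from `t⋆` towards `t₀`
  obtain ⟨p, q, hpq, hqp, hts, hcos⟩ : ∃ p q : ℝ, p ≤ q ∧ q - p = ℓ ∧ tstar ∈ Icc p q ∧
      ∀ t ∈ Icc p q, κ * Real.cos (tstar - t₀) - 1 / 2 ≤ κ * Real.cos (t - t₀) := by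
    by_cases hsin : Real.sin (tstar - t₀) ≤ 0
    · refine ⟨tstar, tstar + ℓ, by linarith, by ring, ⟨le_rfl, by linarith⟩, fun t ht => ?_⟩
      have hu0 : 0 ≤ t - tstar := by linarith [ht.1]
      have hu1 : t - tstar ≤ ℓ := by linarith [ht.2]
      have hc := cornerSL_cos_sub_le_cos_add hu0 (hu1.trans hℓ1) hsin
      rw [show tstar - t₀ + (t - tstar) = t - t₀ by ring] at hc
      have hu2 : κ * (t - tstar) ^ 2 ≤ κ * ℓ ^ 2 :=
        mul_le_mul_of_nonneg_left (pow_le_pow_left₀ hu0 hu1 2) hκ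
      nlinarith [mul_le_mul_of_nonneg_left hc hκ]
    · push Not at hsin
      refine ⟨tstar - ℓ, tstar, by linarith, by ring, ⟨by linarith, le_rfl⟩, fun t ht => ?_⟩
      have hu0 : 0 ≤ tstar - t := by linarith [ht.2]
      have hu1 : tstar - t ≤ ℓ := by linarith [ht.1]
      have hc := cornerSL_cos_sub_le_cos_sub hu0 (hu1.trans hℓ1) hsin.le
      rw [show tstar - t₀ - (tstar - t) = t - t₀ by ring] at hc
      have hu2 : κ * (tstar - t) ^ 2 ≤ κ * ℓ ^ 2 :=
        mul_le_mul_of_nonneg_left (pow_le_pow_left₀ hu0 hu1 2) hκ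
      nlinarith [mul_le_mul_of_nonneg_left hc hκ]
  have hlen : q - p ≤ 1 := hqp ▸ hℓ1
  -- the good set of the arc-doubling bound
  set J' : Set ℝ := {t ∈ Icc p q | ‖Q.eval (exp (tstar * I))‖ ≤ (50 * m + 51 : ℝ) ^ m * ‖Q.eval (exp (t * I))‖}
    with hJ'
  have hvol : ENNReal.ofReal (3 / 4 * (q - p)) ≤ volume J' := cornerSL_arc_doubling m Q hQ hpq hlen hts
  have hJ'meas : MeasurableSet J' := by
    have hc : Continuous fun t : ℝ => (50 * m + 51 : ℝ) ^ m * ‖Q.eval (exp (t * I))‖ :=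
      continuous_const.mul (Q.continuous.comp (continuous_exp.comp (continuous_ofReal.mul continuous_const))).norm
    exact measurableSet_Icc.inter (isClosed_le continuous_const hc).measurableSet
  have hJ'sub : J' ⊆ Icc p q := fun t ht => ht.1
  -- pointwise comparison on the good set
  have hpt : ∀ t ∈ J', h tstar ≤ (2 * K) * h t := by
    intro t ht
    obtain ⟨htI, hQt⟩ := ht
    have hc := hcos t htI
    have hexp : Real.exp (A + κ * Real.cos (tstar - t₀)) ≤ 2 * Real.exp (A + κ * Real.cos (t - t₀)) := by
      have h1 : Real.exp (A + κ * Real.cos (tstar - t₀)) ≤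
          Real.exp (A + κ * Real.cos (t - t₀)) * Real.exp (1 / 2) := by
        rw [← Real.exp_add]
        exact Real.exp_le_exp.2 (by linarith)
      have h2 : Real.exp (1 / 2 : ℝ) ≤ 2 := by
        have h3 : Real.exp (1 / 2 : ℝ) ^ 2 = Real.exp 1 := by
          rw [← Real.exp_nat_mul]; norm_num
        have h4 : Real.exp 1 ≤ 4 := by
          have := Real.exp_one_lt_d9; linarith
        nlinarith [Real.exp_pos (1 / 2 : ℝ)]
      nlinarith [Real.exp_pos (A + κ * Real.cos (t - t₀))]
    simp only [hh]
    calc ‖Q.eval (exp (tstar * I))‖ * Real.exp (A + κ * Real.cos (tstar - t₀))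
        ≤ (K * ‖Q.eval (exp (t * I))‖) * (2 * Real.exp (A + κ * Real.cos (t - t₀))) :=
          mul_le_mul hQt hexp (Real.exp_pos _).le (mul_nonneg hK0.le (norm_nonneg _))
      _ = (2 * K) * (‖Q.eval (exp (t * I))‖ * Real.exp (A + κ * Real.cos (t - t₀))) := by ring
  -- integrate over the good set
  have hmain : ENNReal.ofReal (h tstar) * ENNReal.ofReal (3 / 4 * ℓ) ≤
      ENNReal.ofReal (2 * K) * ∫⁻ t in Ioc 0 (2 * π), ENNReal.ofReal (h t) := by
    calc ENNReal.ofReal (h tstar) * ENNReal.ofReal (3 / 4 * ℓ)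
        ≤ ENNReal.ofReal (h tstar) * volume J' := by rw [← hqp]; exact mul_le_mul' le_rfl hvol
      _ = ∫⁻ t in J', ENNReal.ofReal (h tstar) := (setLIntegral_const _ _).symm
      _ ≤ ∫⁻ t in J', ENNReal.ofReal (2 * K) * ENNReal.ofReal (h t) := by
          refine setLIntegral_mono' hJ'meas fun t ht => ?_
          rw [← ENNReal.ofReal_mul (by positivity)]
          exact ENNReal.ofReal_le_ofReal (hpt t ht)
      _ = ENNReal.ofReal (2 * K) * ∫⁻ t in J', ENNReal.ofReal (h t) := by
          rw [lintegral_const_mul']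
          exact ENNReal.ofReal_ne_top
      _ ≤ ENNReal.ofReal (2 * K) * ∫⁻ t in Icc p q, ENNReal.ofReal (h t) :=
          mul_le_mul' le_rfl (lintegral_mono_set hJ'sub)
      _ ≤ ENNReal.ofReal (2 * K) * ∫⁻ t in Ioc (q - 2 * π) (q - 2 * π + 2 * π), ENNReal.ofReal (h t) := by
          refine mul_le_mul' le_rfl (lintegral_mono_set fun t ht => ⟨?_, ?_⟩)
          · linarith [ht.1]
          · linarith [ht.2]
      _ = ENNReal.ofReal (2 * K) * ∫⁻ t in Ioc 0 (2 * π), ENNReal.ofReal (h t) := by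
          rw [cornerSL_lintegral_Ioc_periodic (f := fun t => ENNReal.ofReal (h t))
            (fun t => congrArg ENNReal.ofReal (cornerSL_weight_periodic Q A κ t₀ t)) (q - 2 * π) 0, zero_add]
  -- divide by `3ℓ/4`
  have h34 : 0 < 3 / 4 * ℓ := by positivity
  have hconst : ENNReal.ofReal (2 * K) =
      ENNReal.ofReal (8 / 3 * K * Real.sqrt (1 + κ)) * ENNReal.ofReal (3 / 4 * ℓ) := by
    rw [← ENNReal.ofReal_mul (by positivity)]
    congr 1
    rw [hℓ]
    field_simp
    ring
  have hle3 : ENNReal.ofReal (8 / 3 * K * Real.sqrt (1 + κ)) ≤ ENNReal.ofReal (3 * K * Real.sqrt (1 + κ)) :=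
    ENNReal.ofReal_le_ofReal (by nlinarith [mul_pos hK0 hsq0])
  have hne0 : ENNReal.ofReal (3 / 4 * ℓ) ≠ 0 := by
    rw [Ne, ENNReal.ofReal_eq_zero, not_le]; exact h34
  have key : ENNReal.ofReal (h tstar) * ENNReal.ofReal (3 / 4 * ℓ) ≤
      (ENNReal.ofReal (8 / 3 * K * Real.sqrt (1 + κ)) * ∫⁻ t in Ioc 0 (2 * π), ENNReal.ofReal (h t)) *
        ENNReal.ofReal (3 / 4 * ℓ) := by
    calc _ ≤ ENNReal.ofReal (2 * K) * ∫⁻ t in Ioc 0 (2 * π), ENNReal.ofReal (h t) := hmain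
      _ = _ := by rw [hconst]; ring
  exact ((ENNReal.mul_le_mul_iff_left hne0 ENNReal.ofReal_ne_top).1 key).trans (mul_le_mul' hle3 le_rfl)

end Summit.QuantumFields.QCD.Cruxes.WindowExtinction.CornerDecorrelationDeepHole

end
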